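import Summits.Ventures.HodgeKum4.Theorems.KummerFixedLocusPointCountAssembly
import HarnessLib

/-!
# Sections of the terminal object versus complex points; the odd torsor (existence half)
# (cell `hodge-kum4`, seat p2; helpers for "Route A" to the atom (H3), item stmt-Ventures-19595)

HONEST FRAMING.  Elementary category-level lemmas; nothing about `K⁴(A)`, (H3) or the Hodge conjecture
is proved in this file.

* §1 `exists_fixed_of_transitive`: the EXISTENCE half of the odd-torsor lemma in the instance-free
  form of `eq_of_fixed_of_transitive` (`Theorems/KummerFixedLocusPointCountAssembly`): a map `σ` of a
  transitive `P`-set with `σ (p • a) = p⁻¹ • σ a`, `P` of odd exponent, has a fixed point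
  (`q • a₀` with `q² • a₀ = σ a₀`).
* §2 the two models of a complex point of `X : Over (Spec ℂ)` — sections `s : 𝟙_ ⟶ X` of the
  terminal object and `Spec ℂ`-points `Q : specOver ℂ ℂ ⟶ X` (`Motives.ComplexPoints X`) — and the
  dictionary `s ↦ toUnit ≫ s`, `Q ↦ toSpecOver ≫ Q` (mutually inverse, both objects being terminal);
  the range of `AlgPoints.mapContinuous c` for `c : 𝟙_ ⟶ X` is one point; a section of a separated
  `X` is a closed immersion.
-/

noncomputable section

open CategoryTheory CategoryTheory.Limits MonoidalCategory CartesianMonoidalCategory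
open AlgebraicGeometry
open Literature.AlgebraicGeometry Literature.AlgebraicGeometry.Motives

namespace Summit.Ventures.HodgeKum4

/-! ### §1 The odd torsor: existence of a fixed point (instance-free, as `eq_of_fixed_of_transitive`) -/

/-- **Odd torsor with an inverting map: existence of a fixed point.**  If a group `P` all of whose
elements have odd order acts transitively on a nonempty `S` and `σ (act p a) = act p⁻¹ (σ a)`, then
`σ` has a fixed point: with `act c a₀ = σ a₀` and `c = q²`, the point `act q a₀` is fixed. -/
theorem exists_fixed_of_transitive {P S : Type*} [Group P] (act : P → S → S)
    (act_mul : ∀ p q s, act (p * q) s = act p (act q s))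
    (hodd : ∀ p : P, ∃ m : ℕ, p ^ (2 * m + 1) = 1) (htrans : ∀ a b : S, ∃ p, act p a = b)
    (σ : S → S) (hσ : ∀ p a, σ (act p a) = act p⁻¹ (σ a)) (a₀ : S) :
    ∃ a : S, σ a = a := by
  obtain ⟨c, hc⟩ := htrans a₀ (σ a₀)
  obtain ⟨m, hm⟩ := hodd c
  -- `q = c^(m+1)` satisfies `q² = c`
  refine ⟨act (c ^ (m + 1)) a₀, ?_⟩
  have hq : c ^ (m + 1) * c ^ (m + 1) = c := by
    rw [← pow_add, show m + 1 + (m + 1) = (2 * m + 1) + 1 by ring, pow_succ, hm, one_mul]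
  rw [hσ, ← hc]
  -- `act (q⁻¹) (act c a₀) = act (q⁻¹ * c) a₀ = act q a₀`
  rw [← act_mul]
  congr 1
  rw [inv_mul_eq_iff_eq_mul, hq]

/-! ### §2 Points: sections `𝟙_ ⟶ X` versus complex points `Spec ℂ ⟶ X` -/

section Points

variable {X : Motives.SchemeOver ℂ}

/-- `toSpecOver 𝟙_ ≫ toUnit (Spec ℂ) = 𝟙`. -/
theorem toSpecOver_comp_toUnit :
    Motives.toSpecOver (𝟙_ (Motives.SchemeOver ℂ)) ≫ toUnit (Motives.specOver ℂ ℂ) = 𝟙 _ :=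
  toUnit_unique _ _

/-- `toUnit (Spec ℂ) ≫ toSpecOver 𝟙_ = 𝟙`. -/
theorem toUnit_comp_toSpecOver :
    toUnit (Motives.specOver ℂ ℂ) ≫ Motives.toSpecOver (𝟙_ (Motives.SchemeOver ℂ)) = 𝟙 _ := by
  rw [Motives.eq_toSpecOver (toUnit (Motives.specOver ℂ ℂ) ≫ Motives.toSpecOver _),
    ← Motives.eq_toSpecOver (𝟙 (Motives.specOver ℂ ℂ))]

/-- `toSpecOver 𝟙_ ≫ toUnit (Spec ℂ) ≫ s = s`. -/
theorem toSpecOver_comp_toUnit_comp (s : 𝟙_ (Motives.SchemeOver ℂ) ⟶ X) :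
    Motives.toSpecOver (𝟙_ (Motives.SchemeOver ℂ)) ≫ toUnit (Motives.specOver ℂ ℂ) ≫ s = s := by
  rw [← Category.assoc, toSpecOver_comp_toUnit, Category.id_comp]

/-- Every complex point `Q` is the complex point of the section `toSpecOver 𝟙_ ≫ Q`. -/
theorem toUnit_comp_toSpecOver_comp (Q : Motives.ComplexPoints X) :
    toUnit (Motives.specOver ℂ ℂ) ≫ Motives.toSpecOver (𝟙_ (Motives.SchemeOver ℂ)) ≫ Q = Q := by
  rw [← Category.assoc, toUnit_comp_toSpecOver, Category.id_comp]

/-- `s ↦ toUnit (Spec ℂ) ≫ s` (section ↦ complex point) is injective. -/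
theorem toUnit_comp_injective {s t : 𝟙_ (Motives.SchemeOver ℂ) ⟶ X}
    (h : toUnit (Motives.specOver ℂ ℂ) ≫ s = toUnit (Motives.specOver ℂ ℂ) ≫ t) : s = t := by
  rw [← toSpecOver_comp_toUnit_comp s, ← toSpecOver_comp_toUnit_comp t, h]

/-- The range of `mapContinuous c` on complex points, for `c` out of the terminal object, is the
single point `toUnit (Spec ℂ) ≫ c`. -/
theorem range_mapContinuous_of_unit (c : 𝟙_ (Motives.SchemeOver ℂ) ⟶ X) :
    Set.range (Motives.AlgPoints.mapContinuous (L := ℂ) c) = {toUnit (Motives.specOver ℂ ℂ) ≫ c} := by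
  ext Q
  simp only [Set.mem_range, Motives.AlgPoints.mapContinuous_apply, Motives.AlgPoints.map_apply,
    Set.mem_singleton_iff]
  constructor
  · rintro ⟨R, rfl⟩
    rw [toUnit_unique R (toUnit _)]
  · rintro rfl
    exact ⟨toUnit _, rfl⟩

/-- A section of the terminal object of `Over (Spec ℂ)` into a separated `X` is a closed immersion. -/
theorem isClosedImmersion_left_of_unit (c : 𝟙_ (Motives.SchemeOver ℂ) ⟶ X) [IsSeparated X.hom] :
    IsClosedImmersion c.left := by
  have hw : c.left ≫ X.hom = (𝟙_ (Motives.SchemeOver ℂ)).hom := Over.w c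
  haveI : IsClosedImmersion (c.left ≫ X.hom) := by
    rw [hw]
    change IsClosedImmersion (𝟙 _)
    infer_instance
  exact IsClosedImmersion.of_comp c.left X.hom

end Points

end Summit.Ventures.HodgeKum4

end
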